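import Mathlib
import HarnessLib
import HarnessLib.Audit
import Summits.MatrixMultiplication.MatrixMultiplication.Theses.RootDecomp1
import Literature.Computability.AlgebraicComplexity.AsymptoticRankZariskiClosedProofs
import Literature.Computability.AlgebraicComplexity.MatrixMultiplicationExponent
import Literature.Computability.AlgebraicComplexity.TensorRestrictionRank

/-!
# FourThirdsLawUpToTwo — the n^{4/3} asymptotic-rank law at the formats d ≤ 2, and the glue of
the split of `FourThirdsLaw` (kernel; two items of `route-MatrixMultiplication-RootDecomp1`)

* `FourThirdsLawUpToTwo_holds :
    Summit.MatrixMultiplication.MatrixMultiplication.Theses.RootDecomp1.FourThirdsLawUpToTwo`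
  (item `stmt-MatrixMultiplication-24510`): `∀ d ≤ 2, ∀ T : Fin d → Fin d → Fin d → ℂ, R̃(T) ≤ d^{4/3}`;
* `FourThirdsLawGlue_holds : ….RootDecomp1.FourThirdsLawGlue` (item `stmt-MatrixMultiplication-24513`):
  `UpToTwo → AtThree → FromFour → FourThirdsLaw` (case split on `d`).

Proof of the first (classification-free). d = 0, 1: `R̃(T) ≤ R(T) ≤ d³ ≤ d^{4/3}`. d = 2: the
sharp `asymptoticRank_le_two : R̃(T) ≤ 2` for EVERY `T ∈ ℂ² ⊗ ℂ² ⊗ ℂ²`: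
* generic case (slice `A = T 0` invertible and the pencil `det(sA + B)`, `B = T 1`, with two
  distinct roots `s₁ ≠ s₂`): `C_i := s_i A + B` are singular, hence rank-one matrices `x_i ⊗ y_i`,
  and `A, B ∈ span(C₁, C₂)`, so `T = w₁ ⊗ C₁ + w₂ ⊗ C₂` has rank ≤ 2
  (`asymptoticRank_le_two_of_generic`);
* the generic locus is dense: two explicit one-parameter perturbations (`B`'s first column
  `+= δ ·` `A`'s first column, then `A += ε·I`) whose obstructions are quadratics in `δ`, `ε` with
  non-zero leading coefficient, hence avoided along a sequence tending to `0`
  (`exists_seq_tendsto_quadratic_ne`);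
* `{T | R̃(T) ≤ 2}` is (Zariski-, hence Euclidean-) CLOSED — tree THEOREM
  `chnvz_zariskiClosed_asymptoticRank_le_holds` (Christandl–Hoeberechts–Nieuwboer–Vrana–Zuiddam,
  arXiv:2411.15789, Thm 1.2) through its corollary `.isClosed_complex`; pass to the limit twice
  (`IsClosed.mem_of_tendsto`).
So the border-rank / orbit classification of `ℂ²⊗ℂ²⊗ℂ²` is never needed. Axiom closure of both
item theorems: `propext, Classical.choice, Quot.sound`.
-/

open Filter Topology
open scoped BigOperators
open Literature.Computability.AlgebraicComplexity

set_option linter.dupNamespace false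

namespace Summit.MatrixMultiplication.MatrixMultiplication.Theorems.FourThirdsLawUpToTwoProof

/-! ### A. A singular 2 × 2 matrix is a product `x ⊗ y` -/

/-- A `2 × 2` complex matrix with zero determinant factors as `C b c = x b * y c`. -/
theorem exists_mul_of_det_two_eq_zero (C : Fin 2 → Fin 2 → ℂ)
    (h : C 0 0 * C 1 1 - C 0 1 * C 1 0 = 0) :
    ∃ x y : Fin 2 → ℂ, ∀ b c, C b c = x b * y c := by
  by_cases h00 : C 0 0 = 0
  · by_cases h01 : C 0 1 = 0
    · refine ⟨![0, 1], ![C 1 0, C 1 1], ?_⟩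
      intro b c
      fin_cases b <;> fin_cases c <;> simp [h00, h01]
    · refine ⟨![C 0 1, C 1 1], ![C 0 0 / C 0 1, 1], ?_⟩
      have h11 : C 1 0 = C 1 1 * (C 0 0 / C 0 1) := by
        field_simp
        linear_combination -h
      intro b c
      fin_cases b <;> fin_cases c
      · simp; field_simp
      · simp
      · simpa using h11
      · simp
  · refine ⟨![C 0 0, C 1 0], ![1, C 0 1 / C 0 0], ?_⟩
    have h11 : C 1 1 = C 1 0 * (C 0 1 / C 0 0) := by
      field_simp
      linear_combination h
    intro b c
    fin_cases b <;> fin_cases c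
    · simp
    · simp; field_simp
    · simp
    · simpa using h11

/-! ### B. Two singular slices of span give `R̃ ≤ 2` -/

/-- If `T = w₁ ⊗ C₁ + w₂ ⊗ C₂` with `C₁, C₂` singular `2 × 2` matrices then `R̃(T) ≤ 2`
(indeed `R(T) ≤ 2`). -/
theorem asymptoticRank_le_two_of_slices (T : Fin 2 → Fin 2 → Fin 2 → ℂ)
    (w₁ w₂ : Fin 2 → ℂ) (C₁ C₂ : Fin 2 → Fin 2 → ℂ)
    (h₁ : C₁ 0 0 * C₁ 1 1 - C₁ 0 1 * C₁ 1 0 = 0)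
    (h₂ : C₂ 0 0 * C₂ 1 1 - C₂ 0 1 * C₂ 1 0 = 0)
    (hT : ∀ a b c, T a b c = w₁ a * C₁ b c + w₂ a * C₂ b c) :
    asymptoticRank T ≤ 2 := by
  classical
  obtain ⟨x₁, y₁, e₁⟩ := exists_mul_of_det_two_eq_zero C₁ h₁
  obtain ⟨x₂, y₂, e₂⟩ := exists_mul_of_det_two_eq_zero C₂ h₂
  refine (asymptoticRank_le_tensorRank_pow_one T).trans ?_
  have hR : tensorRank (kroneckerPow T 1) ≤ 2 := by
    refine tensorRank_le_of_eq_sum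
      (![fun a : Fin 1 → Fin 2 => w₁ (a 0), fun a => w₂ (a 0)])
      (![fun b : Fin 1 → Fin 2 => x₁ (b 0), fun b => x₂ (b 0)])
      (![fun c : Fin 1 → Fin 2 => y₁ (c 0), fun c => y₂ (c 0)]) ?_
    funext a b c
    simp only [Finset.sum_apply, triad_apply, kroneckerPow_apply, Fin.prod_univ_one,
      Fin.sum_univ_two, hT, e₁, e₂, Matrix.cons_val_zero, Matrix.cons_val_one]
    ring
  exact_mod_cast hR


/-! ### C. The generic rank-two decomposition (two singular members of the pencil) -/

section Generic

variable (T : Fin 2 → Fin 2 → Fin 2 → ℂ)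

/-- `det A` of the slice `A = T 0`. -/
def detA : ℂ := T 0 0 0 * T 0 1 1 - T 0 0 1 * T 0 1 0

/-- `det B` of the slice `B = T 1`. -/
def detB : ℂ := T 1 0 0 * T 1 1 1 - T 1 0 1 * T 1 1 0

/-- The mixed coefficient `m` of the pencil: `det(sA + B) = detA·s² + m·s + detB`. -/
def mixed : ℂ := T 0 0 0 * T 1 1 1 + T 0 1 1 * T 1 0 0 - T 0 0 1 * T 1 1 0 - T 0 1 0 * T 1 0 1

/-- The discriminant of the pencil `det(sA + B)`. -/
def disc : ℂ := mixed T ^ 2 - 4 * detA T * detB T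

/-- Expansion of the pencil determinant. -/
theorem det_pencil (s : ℂ) :
    (s * T 0 0 0 + T 1 0 0) * (s * T 0 1 1 + T 1 1 1) - (s * T 0 0 1 + T 1 0 1) * (s * T 0 1 0 + T 1 1 0)
      = detA T * s ^ 2 + mixed T * s + detB T := by
  simp only [detA, detB, mixed]; ring

/-- GENERIC CASE: `det A ≠ 0` and the pencil has two distinct roots (`disc ≠ 0`, `σ² = disc`) ⟹
`R̃(T) ≤ 2`: `T = w₁ ⊗ (s₁A + B) + w₂ ⊗ (s₂A + B)` with `s_{1,2} = (-m ± σ)/(2 det A)`. -/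
theorem asymptoticRank_le_two_of_generic (σ : ℂ) (hA : detA T ≠ 0) (hσ : σ ≠ 0)
    (hσ2 : σ ^ 2 = disc T) : asymptoticRank T ≤ 2 := by
  have h2A : 2 * detA T ≠ 0 := mul_ne_zero two_ne_zero hA
  set s₁ : ℂ := (-mixed T + σ) / (2 * detA T) with hs₁
  set s₂ : ℂ := (-mixed T - σ) / (2 * detA T) with hs₂
  have root₁ : detA T * s₁ ^ 2 + mixed T * s₁ + detB T = 0 := by
    rw [hs₁]; field_simp; unfold disc at hσ2; linear_combination hσ2
  have root₂ : detA T * s₂ ^ 2 + mixed T * s₂ + detB T = 0 := by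
    rw [hs₂]; field_simp; unfold disc at hσ2; linear_combination hσ2
  refine asymptoticRank_le_two_of_slices T
    ![detA T / σ, 1 / 2 + mixed T / (2 * σ)] ![-(detA T / σ), 1 / 2 - mixed T / (2 * σ)]
    (fun b c => s₁ * T 0 b c + T 1 b c) (fun b c => s₂ * T 0 b c + T 1 b c)
    (by rw [det_pencil]; exact root₁) (by rw [det_pencil]; exact root₂) ?_
  intro a b c
  fin_cases a
  · simp only [Fin.zero_eta, Fin.isValue, Matrix.cons_val_zero]
    rw [hs₁, hs₂]; field_simp; ring
  · simp only [Fin.mk_one, Fin.isValue, Matrix.cons_val_one, Matrix.cons_val_fin_one]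
    rw [hs₁, hs₂]; field_simp; ring

end Generic

/-! ### D. Avoiding the zeros of a genuine quadratic along a sequence tending to `0` -/

/-- A quadratic `αu² + βu + γ` with `α ≠ 0` has at most two roots: three distinct roots are
impossible. -/
theorem quadratic_ne_zero_of_two_roots {α β γ u₁ u₂ u₃ : ℂ} (hα : α ≠ 0) (h12 : u₁ ≠ u₂)
    (h13 : u₁ ≠ u₃) (h23 : u₂ ≠ u₃) (h₁ : α * u₁ ^ 2 + β * u₁ + γ = 0)
    (h₂ : α * u₂ ^ 2 + β * u₂ + γ = 0) : α * u₃ ^ 2 + β * u₃ + γ ≠ 0 := by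
  intro h₃
  have e12 : α * (u₁ + u₂) + β = 0 := by
    have : (u₁ - u₂) * (α * (u₁ + u₂) + β) = 0 := by linear_combination h₁ - h₂
    exact (mul_eq_zero.1 this).resolve_left (sub_ne_zero.2 h12)
  have e13 : α * (u₁ + u₃) + β = 0 := by
    have : (u₁ - u₃) * (α * (u₁ + u₃) + β) = 0 := by linear_combination h₁ - h₃
    exact (mul_eq_zero.1 this).resolve_left (sub_ne_zero.2 h13)
  have : α * (u₂ - u₃) = 0 := by linear_combination e12 - e13
  rcases mul_eq_zero.1 this with h | h
  · exact hα h
  · exact h23 (sub_eq_zero.1 h)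

/-- The test sequence `v k = 1/(k+1)` (real, seen in `ℂ`). -/
noncomputable def vseq (k : ℕ) : ℂ := ((1 / ((k : ℝ) + 1) : ℝ) : ℂ)

/-- The test sequence `vseq` is injective. -/
theorem vseq_injective : Function.Injective vseq := by
  intro i j h
  have h' : (1 / ((i : ℝ) + 1) : ℝ) = 1 / ((j : ℝ) + 1) := by
    simpa only [vseq, Complex.ofReal_inj] using h
  have hi : (0 : ℝ) < (i : ℝ) + 1 := by positivity
  have hj : (0 : ℝ) < (j : ℝ) + 1 := by positivity
  rw [div_eq_div_iff hi.ne' hj.ne', one_mul, one_mul] at h'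
  exact_mod_cast (by linarith : (i : ℝ) = j)

/-- `‖vseq k‖ ≤ 1/(n+1)` for `n ≤ k`. -/
theorem norm_vseq_le {n k : ℕ} (h : n ≤ k) : ‖vseq k‖ ≤ 1 / ((n : ℝ) + 1) := by
  unfold vseq
  rw [Complex.norm_real, Real.norm_eq_abs, abs_of_nonneg (by positivity)]
  exact one_div_le_one_div_of_le (by positivity) (by exact_mod_cast Nat.succ_le_succ h)

/-- Along a sequence tending to `0` the quadratic `αu² + βu + γ` (`α ≠ 0`) is never zero. -/
theorem exists_seq_tendsto_quadratic_ne {α : ℂ} (β γ : ℂ) (hα : α ≠ 0) :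
    ∃ δ : ℕ → ℂ, Tendsto δ atTop (𝓝 0) ∧ ∀ n, α * δ n ^ 2 + β * δ n + γ ≠ 0 := by
  classical
  let q : ℂ → ℂ := fun u => α * u ^ 2 + β * u + γ
  let δ : ℕ → ℂ := fun n =>
    if q (vseq (3 * n)) ≠ 0 then vseq (3 * n)
    else if q (vseq (3 * n + 1)) ≠ 0 then vseq (3 * n + 1) else vseq (3 * n + 2)
  have hδmem : ∀ n, ∃ k, 3 * n ≤ k ∧ δ n = vseq k := by
    intro n
    simp only [δ]
    split_ifs
    · exact ⟨3 * n, le_rfl, rfl⟩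
    · exact ⟨3 * n + 1, by omega, rfl⟩
    · exact ⟨3 * n + 2, by omega, rfl⟩
  refine ⟨δ, ?_, ?_⟩
  · refine squeeze_zero_norm (a := fun n : ℕ => 1 / ((n : ℝ) + 1)) (fun n => ?_)
      tendsto_one_div_add_atTop_nhds_zero_nat
    obtain ⟨k, hk, e⟩ := hδmem n
    rw [e]
    exact norm_vseq_le (by omega)
  · intro n
    simp only [δ]
    split_ifs with h0 h1
    · exact h0
    · exact h1
    · push Not at h0 h1
      exact quadratic_ne_zero_of_two_roots hα
        (fun h => by have := vseq_injective h; omega)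
        (fun h => by have := vseq_injective h; omega)
        (fun h => by have := vseq_injective h; omega) h0 h1

/-! ### E. Density of the generic locus + closedness of `{R̃ ≤ 2}` -/

/-- `{t : ℂ²⊗ℂ²⊗ℂ² | R̃(t) ≤ 2}` is closed (CHNVZ Thm 1.2, tree theorem). -/
theorem isClosed_asymptoticRank_le_two :
    IsClosed {t : Fin 2 → Fin 2 → Fin 2 → ℂ | asymptoticRank t ≤ 2} := by
  simpa using chnvz_zariskiClosed_asymptoticRank_le_holds.isClosed_complex
    (ι := Fin 2) (κ := Fin 2) (μ := Fin 2) (2 : ℝ)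

section Perturb

variable (T : Fin 2 → Fin 2 → Fin 2 → ℂ)

/-- First perturbation: column `0` of the slice `B = T 1` moves by `δ ·` column `0` of `A = T 0`. -/
def colPerturb (δ : ℂ) : Fin 2 → Fin 2 → Fin 2 → ℂ :=
  fun a b c => T a b c + if a = 1 ∧ c = 0 then δ * T 0 b 0 else 0

/-- The coefficient `k` in `disc(colPerturb T δ) = detA² δ² + 2·detA·k·δ + disc`. -/
def kcoef : ℂ := T 0 1 1 * T 1 0 0 - T 0 0 1 * T 1 1 0 - T 0 0 0 * T 1 1 1 + T 0 1 0 * T 1 0 1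

/-- The column perturbation leaves `detA` unchanged. -/
theorem detA_colPerturb (δ : ℂ) : detA (colPerturb T δ) = detA T := by
  simp [detA, colPerturb]

/-- The discriminant of the column perturbation is the quadratic `detA² δ² + 2·detA·k·δ + disc`. -/
theorem disc_colPerturb (δ : ℂ) :
    disc (colPerturb T δ) = detA T ^ 2 * δ ^ 2 + 2 * detA T * kcoef T * δ + disc T := by
  simp [disc, mixed, detA, detB, kcoef, colPerturb]
  ring

/-- The column perturbation tends to `T` as `δ → 0`. -/
theorem tendsto_colPerturb {δ : ℕ → ℂ} (hδ : Tendsto δ atTop (𝓝 0)) :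
    Tendsto (fun n => colPerturb T (δ n)) atTop (𝓝 T) := by
  rw [tendsto_pi_nhds]; intro a
  rw [tendsto_pi_nhds]; intro b
  rw [tendsto_pi_nhds]; intro c
  simp only [colPerturb]
  split_ifs
  · simpa using ((hδ.mul_const (T 0 b 0)).const_add (T a b c))
  · simp

/-- Second perturbation: the slice `A = T 0` moves by `ε · I`. -/
def diagPerturb (ε : ℂ) : Fin 2 → Fin 2 → Fin 2 → ℂ :=
  fun a b c => T a b c + if a = 0 ∧ b = c then ε else 0

/-- `detA` of the diagonal perturbation is the quadratic `ε² + tr(A)·ε + detA`. -/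
theorem detA_diagPerturb (ε : ℂ) :
    detA (diagPerturb T ε) = 1 * ε ^ 2 + (T 0 0 0 + T 0 1 1) * ε + detA T := by
  simp [detA, diagPerturb]
  ring

/-- The diagonal perturbation tends to `T` as `ε → 0`. -/
theorem tendsto_diagPerturb {ε : ℕ → ℂ} (hε : Tendsto ε atTop (𝓝 0)) :
    Tendsto (fun n => diagPerturb T (ε n)) atTop (𝓝 T) := by
  rw [tendsto_pi_nhds]; intro a
  rw [tendsto_pi_nhds]; intro b
  rw [tendsto_pi_nhds]; intro c
  simp only [diagPerturb]
  split_ifs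
  · simpa using (hε.const_add (T a b c))
  · simp

/-- `det A ≠ 0` ⟹ `R̃(T) ≤ 2` (limit of generic tensors along the first perturbation). -/
theorem asymptoticRank_le_two_of_detA_ne_zero (hA : detA T ≠ 0) : asymptoticRank T ≤ 2 := by
  obtain ⟨δ, hδ0, hδ⟩ :=
    exists_seq_tendsto_quadratic_ne (2 * detA T * kcoef T) (disc T) (pow_ne_zero 2 hA)
  refine isClosed_asymptoticRank_le_two.mem_of_tendsto (tendsto_colPerturb T hδ0)
    (Eventually.of_forall fun n => ?_)
  show asymptoticRank (colPerturb T (δ n)) ≤ 2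
  have hdisc : disc (colPerturb T (δ n)) ≠ 0 := by rw [disc_colPerturb]; exact hδ n
  obtain ⟨σ, hσ⟩ := IsAlgClosed.exists_pow_nat_eq (disc (colPerturb T (δ n))) two_pos
  have hσ0 : σ ≠ 0 := by
    rintro rfl
    exact hdisc (by rw [← hσ]; simp)
  exact asymptoticRank_le_two_of_generic _ σ (by rw [detA_colPerturb]; exact hA) hσ0 hσ

/-- **Every tensor in `ℂ² ⊗ ℂ² ⊗ ℂ²` has asymptotic rank at most `2`** (sharp: `R̃(⟨2⟩) = 2`). -/
theorem asymptoticRank_le_two : asymptoticRank T ≤ 2 := by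
  obtain ⟨ε, hε0, hε⟩ :=
    exists_seq_tendsto_quadratic_ne (T 0 0 0 + T 0 1 1) (detA T) (one_ne_zero (α := ℂ))
  refine isClosed_asymptoticRank_le_two.mem_of_tendsto (tendsto_diagPerturb T hε0)
    (Eventually.of_forall fun n => ?_)
  show asymptoticRank (diagPerturb T (ε n)) ≤ 2
  exact asymptoticRank_le_two_of_detA_ne_zero _ (by rw [detA_diagPerturb]; exact hε n)

end Perturb

/-! ### F. The leaf: the `n^{4/3}` law at the formats `d ≤ 2` -/

/-- The trivial bound `R̃(T) ≤ d³` (`R̃ ≤ R ≤ |ι|·|κ|·|μ|`). -/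
theorem asymptoticRank_le_cube {d : ℕ} (T : Fin d → Fin d → Fin d → ℂ) :
    asymptoticRank T ≤ (d : ℝ) ^ 3 := by
  classical
  refine (asymptoticRank_le_tensorRank_pow_one T).trans ?_
  have h := tensorRank_le_card (kroneckerPow T 1)
  simp only [Fintype.card_fun, Fintype.card_fin, pow_one] at h
  have h' : (tensorRank (kroneckerPow T 1) : ℝ) ≤ (d : ℝ) * d * d := by exact_mod_cast h
  calc (tensorRank (kroneckerPow T 1) : ℝ) ≤ (d : ℝ) * d * d := h'
    _ = (d : ℝ) ^ 3 := by ring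

/-- `2 ≤ 2^{4/3}`. -/
theorem two_le_two_rpow_four_thirds : (2 : ℝ) ≤ (2 : ℝ) ^ (4 / 3 : ℝ) := by
  have h : (2 : ℝ) ^ (1 : ℝ) ≤ (2 : ℝ) ^ (4 / 3 : ℝ) :=
    Real.rpow_le_rpow_of_exponent_le (by norm_num) (by norm_num)
  simpa using h

/-- **LEAF `stmt-MatrixMultiplication-24510` IN KERNEL**: the `n^{4/3}` law of
`route-MatrixMultiplication-RootDecomp1` at every format `d ≤ 2`. -/
theorem FourThirdsLawUpToTwo_holds :
    Summit.MatrixMultiplication.MatrixMultiplication.Theses.RootDecomp1.FourThirdsLawUpToTwo := by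
  intro d hd T
  interval_cases d
  · have h := asymptoticRank_le_cube T
    have h0 : ((0 : ℕ) : ℝ) ^ (4 / 3 : ℝ) = 0 := by
      rw [Nat.cast_zero, Real.zero_rpow (by norm_num)]
    rw [h0]
    simpa using h
  · have h := asymptoticRank_le_cube T
    simpa using h
  · exact (asymptoticRank_le_two T).trans (by exact_mod_cast two_le_two_rpow_four_thirds)


/-- **LEAF `stmt-MatrixMultiplication-24513` (the GLUE of the split of `FourThirdsLaw`) IN KERNEL**:
`UpToTwo → AtThree → FromFour → FourThirdsLaw` (case split on the format `d`). -/
theorem FourThirdsLawGlue_holds :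
    Summit.MatrixMultiplication.MatrixMultiplication.Theses.RootDecomp1.FourThirdsLawGlue := by
  intro h2 h3 h4 d T
  rcases Nat.lt_or_ge d 4 with hlt | hge
  · interval_cases d
    · exact h2 0 (by norm_num) T
    · exact h2 1 (by norm_num) T
    · exact h2 2 (by norm_num) T
    · simpa using h3 T
  · exact h4 d hge T

end Summit.MatrixMultiplication.MatrixMultiplication.Theorems.FourThirdsLawUpToTwoProof
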